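import Summits.Schanuel.Schanuel.Theses.TateNomes
import Literature.NumberTheory.Transcendental.OneMotiveToricProofs

/-! # Disproof work file — crux `NomeHygiene` (stmt-Schanuel-17298, route `TateNomes`)

By refuter-cdisprove-stmt-Schanuel-17298-0 (cycle 1, 2026-08-17).

## Status: the crux RESISTS — it is PROVED
`Cruxes/NomeHygiene/NomeHygieneComplete.lean` (`nomeHygiene_holds`, sorry-free, rc 0, standard axioms;
line `integer_shift_rebase`, stubs landed p157715 `stub_shiftCoincidence`, p157723 `stub_shiftedTateBasis`).
No counterexample exists; this file records WHY each feature of the statement is needed (load-bearing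
analysis) and which natural strengthenings are false — briefing for the repair of neighbouring items.

## Findings (all sorry-free)
* `nomeHygiene_false_without_linIndep` — the only hypothesis `LinearIndependent ℚ z` is load-bearing:
  the rigid count `w : Fin (n + k)` + `LinearIndependent ℚ w` + span equality forces
  `dim span (z, e) = n + k`, false for `z = 0 : Fin 1 → ℂ`.
* `no_tatePosition_of_le_two` — NO tuple of length `≤ 2` is in Tate position: `2πi ∈ span w` makes a nome
  rational (`m = 1`) or gives the affine `GL₂⁺(ℚ)`-relation `τ₁ = ατ₀ + β`, `α > 0` forced by `Im τ > 0`
  (`m = 2`). Hence every witness of the crux has `3 ≤ n + k` (`three_le_of_witness`), and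
* `not_nomeHygieneKLeTwo` — the strengthening "`k ≤ 2` always suffices" is FALSE (`n = 0` needs `k = 3`);
  the proved line uses `k ≤ 3`, so its enlargement bound is SHARP.
* `nomeHygiene_false_without_expOption` — the disjunct `IsAlgebraic ℚ (exp (e i))` is load-bearing: with
  algebraic `e` only, `span (z, e)` is inside `ℚ̄` for `n = 0`, so `2πi ∉ span` (Lindemann, tree
  `transcendental_two_pi_I`).
* `cubicTrap` — the route's stated worry is REAL for the un-enlarged span and is a cubic-field
  phenomenon: if `τ³ ∈ span_ℚ(1, τ, τ²) =: K` then ANY two points of `K ∩ ℍ` are `GL₂⁺(ℚ)`-related in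
  the crux's polynomial form (`1, x, y, xy` dependent in the 3-dimensional algebra `K`; sign of the
  determinant from `Im y·|cx+d|² = det·Im x`). Hence
  `nomeHygiene_false_without_enlargement` — the `k = 0` form (re-base `span z` itself) is FALSE even with
  `2πi ∈ span z`, `n = 3`: cell `z = 2πi·(1, τ₀, τ₀²)`, `τ₀ = ∛2·e^{iπ/3}` (`τ₀³ = −2`, irreducible by
  the 2-adic valuation; `1, τ₀, τ₀²` independent via `minpoly`); any proof must ENLARGE (the line adjoins
  `e = −1` and shifts along the transcendental `−1/2πi`); and
  `not_finite_shift_coincidences` — the docstring's "at most two `t ∈ ℕ` make `u + t·v` equivalent to a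
  given point" is FALSE for the algebraic direction `v = τ₀²` (`u = p = τ₀`): EVERY `t` is a coincidence.
  The landed Key Lemma `stub_shiftCoincidence` (direction `1/2πi`) is the correct form.

## Landing
`Theorems/NomeHygiene/Negative/LoadBearing.lean` ((a), (b), (a')) and
`Theorems/NomeHygiene/Negative/CubicTrap.lean` ((c)) — `--supports stmt-Schanuel-17298`.

## Why the crux resists (for ideators)
Every obstruction found is removed by ONE adjoined algebraic direction: coincidences and quadraticity
live on countably many proper affine/bilinear conditions which a free transcendental coordinate
(`−t/2πi`, `t ∈ ℕ`) meets finitely often per slot (Key Lemma: three coincidences on one line force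
`1/2πi` algebraic of degree ≤ 3). No arithmetic of the `zᵢ` is ever consulted, so no configuration of
`z` can be adversarial; the only rigid constraints are the dimension count (`n + k ≥ 3`) and Lindemann.
-/

noncomputable section

-- `Summit.Schanuel.Schanuel.…` is the mandated namespace (single-conjunct summit).
set_option linter.dupNamespace false

namespace Summit.Schanuel.Schanuel.Cruxes.NomeHygiene.Disproof

open Complex

/-! ## Common tools -/

theorem twoPiI_ne_zero : (2 * (Real.pi : ℂ) * Complex.I) ≠ 0 :=
  mul_ne_zero (mul_ne_zero two_ne_zero (Complex.ofReal_ne_zero.mpr Real.pi_ne_zero)) Complex.I_ne_zero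

/-- The nome coordinate: `Im (w / 2πi) = - Re w / 2π`. -/
theorem im_div_twoPiI (w : ℂ) :
    (w / (2 * (Real.pi : ℂ) * Complex.I)).im = -w.re / (2 * Real.pi) := by
  have hT := twoPiI_ne_zero
  have hw : w = (2 * (Real.pi : ℂ) * Complex.I) * (w / (2 * (Real.pi : ℂ) * Complex.I)) := by
    field_simp
  have hre : w.re = -(2 * Real.pi) * (w / (2 * (Real.pi : ℂ) * Complex.I)).im := by
    conv_lhs => rw [hw]
    simp [Complex.mul_re]
  have hpi : (2 * Real.pi) ≠ 0 := by positivity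
  field_simp
  linarith

theorem im_div_twoPiI_pos {w : ℂ} (hw : w.re < 0) :
    0 < (w / (2 * (Real.pi : ℂ) * Complex.I)).im := by
  rw [im_div_twoPiI]
  apply div_pos (by linarith) (by positivity)

/-! ## (a) Load-bearing hypothesis: `LinearIndependent ℚ z` -/

/-- The crux `NomeHygiene` with its (only) hypothesis `LinearIndependent ℚ z` DROPPED. -/
def NomeHygieneWithoutLinIndep : Prop :=
  ∀ (n : ℕ) (z : Fin n → ℂ), ∃ (k : ℕ) (e : Fin k → ℂ) (w : Fin (n + k) → ℂ), (∀ i, IsAlgebraic ℚ (e i) ∨ IsAlgebraic ℚ (Complex.exp (e i))) ∧ LinearIndependent ℚ w ∧ Submodule.span ℚ (Set.range w) = Submodule.span ℚ (Set.range z ∪ Set.range e) ∧ (2 * (Real.pi : ℂ) * Complex.I) ∈ Submodule.span ℚ (Set.range w) ∧ (∀ j, (w j).re < 0) ∧ (∀ j, ∀ b c : ℚ, (w j / (2 * (Real.pi : ℂ) * Complex.I)) ^ 2 + (b : ℂ) * (w j / (2 * (Real.pi : ℂ) * Complex.I)) + (c : ℂ) ≠ 0) ∧ (∀ i j, i ≠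 j → ∀ a b c d : ℚ, 0 < a * d - b * c → (w j / (2 * (Real.pi : ℂ) * Complex.I)) * ((c : ℂ) * (w i / (2 * (Real.pi : ℂ) * Complex.I)) + (d : ℂ)) ≠ (a : ℂ) * (w i / (2 * (Real.pi : ℂ) * Complex.I)) + (b : ℂ))

/-- **Any proof must use `LinearIndependent ℚ z`.** Witness `n = 1`, `z = 0`: the conclusion forces
`finrank (span (z, e)) = 1 + k`, but `span (0, e) = span e` has `finrank ≤ k`. [folklore] -/
theorem nomeHygiene_false_without_linIndep : ¬ NomeHygieneWithoutLinIndep := by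
  intro h
  obtain ⟨k, e, w, -, hw, hspan, -⟩ := h 1 (fun _ => 0)
  have h1 : Module.finrank ℚ (Submodule.span ℚ (Set.range w)) = 1 + k := by
    rw [finrank_span_eq_card hw, Fintype.card_fin]
  have hz : Submodule.span ℚ (Set.range (fun _ : Fin 1 => (0 : ℂ))) = ⊥ := by
    rw [Submodule.span_eq_bot]
    rintro x ⟨i, rfl⟩
    rfl
  have h2 : Module.finrank ℚ
      (Submodule.span ℚ (Set.range (fun _ : Fin 1 => (0 : ℂ)) ∪ Set.range e)) ≤ k := by
    rw [Submodule.span_union, hz, bot_sup_eq]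
    exact (finrank_range_le_card e).trans (by simp)
  rw [hspan] at h1
  omega

/-! ## (b) Boundary: no Tate position in dimension `≤ 2`; `k ≤ 3` is sharp -/

/-- Conjuncts 2, 4, 5, 6, 7 of the crux's conclusion (verbatim): `w` is a `ℚ`-independent tuple in
Tate position. -/
def InTatePosition (m : ℕ) (w : Fin m → ℂ) : Prop :=
  LinearIndependent ℚ w ∧ (2 * (Real.pi : ℂ) * Complex.I) ∈ Submodule.span ℚ (Set.range w) ∧ (∀ j, (w j).re < 0) ∧ (∀ j, ∀ b c : ℚ, (w j / (2 * (Real.pi : ℂ) * Complex.I)) ^ 2 + (b : ℂ) * (w j / (2 * (Real.pi : ℂ) * Complex.I)) + (c : ℂ) ≠ 0) ∧ (∀ i j, i ≠ j → ∀ a b c d : ℚ, 0 < a * d - b * c → (w j / (2 * (Real.pi : ℂ) * Complex.I)) * ((c : ℂ) * (w i / (2 * (Real.pi : ℂ) * Complex.I)) + (d : ℂ)) ≠ (a : ℂ) * (w i / (2 * (Real.pi : ℂ) * Complex.I)) + (b : ℂ))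

/-- **No Tate position for `m ≤ 2`.** `m = 0`: `2πi ∈ ⊥`. `m = 1`: `2πi = c·w₀` makes `τ₀ = 1/c`
rational, a root of `X² − (1/c)X`. `m = 2`: `1 = c₀τ₀ + c₁τ₁`; `c₁ = 0` is the previous case, else
`τ₁ = ατ₀ + β` with `α = −c₀/c₁ > 0` because `Im τ₀, Im τ₁ > 0` — the affine relation with
`(a,b,c,d) = (α,β,0,1)`, `ad − bc = α > 0`. [folklore] -/
theorem no_tatePosition_of_le_two {m : ℕ} (hm : m ≤ 2) (w : Fin m → ℂ) : ¬ InTatePosition m w := by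
  rintro ⟨-, hmem, hre, hnq, hiso⟩
  have hT := twoPiI_ne_zero
  obtain ⟨c, hc⟩ := (Submodule.mem_span_range_iff_exists_fun ℚ).1 hmem
  have himpos : ∀ j, 0 < (w j / (2 * (Real.pi : ℂ) * Complex.I)).im :=
    fun j => im_div_twoPiI_pos (hre j)
  interval_cases m
  · -- m = 0
    rw [Fin.sum_univ_zero] at hc
    exact hT hc.symm
  · -- m = 1
    rw [Fin.sum_univ_one, Rat.smul_def] at hc
    have hc0 : (c 0 : ℂ) ≠ 0 := by
      intro h0
      rw [h0, zero_mul] at hc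
      exact hT hc.symm
    have hw0 : w 0 ≠ 0 := by
      intro h0
      have := hre 0
      rw [h0, Complex.zero_re] at this
      exact lt_irrefl _ this
    have hτ : w 0 / (2 * (Real.pi : ℂ) * Complex.I) = ((c 0 : ℚ) : ℂ)⁻¹ := by
      rw [← hc]
      field_simp
    refine hnq 0 (-(c 0)⁻¹) 0 ?_
    rw [hτ]
    push_cast
    ring
  · -- m = 2
    rw [Fin.sum_univ_two, Rat.smul_def, Rat.smul_def] at hc
    by_cases h1 : c 1 = 0
    · rw [h1] at hc
      push_cast at hc
      rw [zero_mul, add_zero] at hc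
      have hc0 : (c 0 : ℂ) ≠ 0 := by
        intro h0
        rw [h0, zero_mul] at hc
        exact hT hc.symm
      have hw0 : w 0 ≠ 0 := by
        intro h0
        have := hre 0
        rw [h0, Complex.zero_re] at this
        exact lt_irrefl _ this
      have hτ : w 0 / (2 * (Real.pi : ℂ) * Complex.I) = ((c 0 : ℚ) : ℂ)⁻¹ := by
        rw [← hc]
        field_simp
      refine hnq 0 (-(c 0)⁻¹) 0 ?_
      rw [hτ]
      push_cast
      ring
    · have h1' : ((c 1 : ℚ) : ℂ) ≠ 0 := by exact_mod_cast h1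
      set τ0 := w 0 / (2 * (Real.pi : ℂ) * Complex.I) with hτ0
      set τ1 := w 1 / (2 * (Real.pi : ℂ) * Complex.I) with hτ1
      have hw0 : w 0 = (2 * (Real.pi : ℂ) * Complex.I) * τ0 := by rw [hτ0]; field_simp
      have hw1 : w 1 = (2 * (Real.pi : ℂ) * Complex.I) * τ1 := by rw [hτ1]; field_simp
      have hlin : (c 0 : ℂ) * τ0 + (c 1 : ℂ) * τ1 = 1 := by
        rw [hw0, hw1] at hc
        have : (2 * (Real.pi : ℂ) * Complex.I) * ((c 0 : ℂ) * τ0 + (c 1 : ℂ) * τ1 - 1) = 0 := by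
          linear_combination hc
        have := (mul_eq_zero.1 this).resolve_left hT
        linear_combination this
      have hrel : τ1 = ((-c 0 / c 1 : ℚ) : ℂ) * τ0 + ((1 / c 1 : ℚ) : ℂ) := by
        push_cast
        field_simp
        linear_combination hlin
      have hα : 0 < -c 0 / c 1 := by
        have him := congrArg Complex.im hrel
        simp only [Complex.add_im, Complex.mul_im, Complex.ratCast_re, Complex.ratCast_im,
          zero_mul, add_zero] at him
        have h0 := himpos 0
        have h1p := himpos 1
        rw [← hτ0] at h0
        rw [← hτ1, him] at h1p
        refine lt_of_not_ge fun hle => ?_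
        have : ((-c 0 / c 1 : ℚ) : ℝ) ≤ 0 := by exact_mod_cast hle
        nlinarith
      refine hiso 0 1 (by decide) (-c 0 / c 1) (1 / c 1) 0 1 (by linarith) ?_
      rw [← hτ0, ← hτ1, hrel]
      push_cast
      ring

/-- Every witness `(k, e, w)` of the crux at `(n, z)` has `3 ≤ n + k`. -/
theorem three_le_of_inTatePosition {m : ℕ} {w : Fin m → ℂ} (h : InTatePosition m w) : 3 ≤ m := by
  by_contra hlt
  exact no_tatePosition_of_le_two (by omega) w h

/-- The natural strengthening "`k ≤ 2` adjoined numbers always suffice" (crux verbatim + `k ≤ 2`). -/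
def NomeHygieneKLeTwo : Prop :=
  ∀ (n : ℕ) (z : Fin n → ℂ), LinearIndependent ℚ z → ∃ (k : ℕ) (e : Fin k → ℂ) (w : Fin (n + k) → ℂ), k ≤ 2 ∧ (∀ i, IsAlgebraic ℚ (e i) ∨ IsAlgebraic ℚ (Complex.exp (e i))) ∧ LinearIndependent ℚ w ∧ Submodule.span ℚ (Set.range w) = Submodule.span ℚ (Set.range z ∪ Set.range e) ∧ (2 * (Real.pi : ℂ) * Complex.I) ∈ Submodule.span ℚ (Set.range w) ∧ (∀ j, (w j).re < 0) ∧ (∀ j, ∀ b c : ℚ, (w j / (2 * (Real.pi : ℂ) * Complex.I)) ^ 2 + (b : ℂ) * (w j / (2 * (Real.pi : ℂ) * Complex.I)) + (c : ℂ) ≠ 0) ∧ (∀ i j, i ≠ j → ∀ a b c d : ℚ, 0 < a * d - b * c → (w j / (2 * (Real.pi : ℂ) * Complex.I)) * ((c : ℂ) * (w i / (2 * (Real.pi : ℂ) * Complex.I)) + (d : ℂ)) ≠ (a : ℂ) * (w i / (2 * (Real.pi : ℂ) * Complex.I)) + (b : ℂ))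

/-- **`k ≤ 3` is sharp**: at `n = 0` any witness has `k = 0 + k ≥ 3`. [folklore] -/
theorem not_nomeHygieneKLeTwo : ¬ NomeHygieneKLeTwo := by
  intro h
  obtain ⟨k, e, w, hk, -, hw, -, hmem, hre, hnq, hiso⟩ :=
    h 0 (Fin.elim0 : Fin 0 → ℂ) linearIndependent_empty_type
  have h3 : 3 ≤ 0 + k := three_le_of_inTatePosition ⟨hw, hmem, hre, hnq, hiso⟩
  omega

/-! ## (a') Load-bearing disjunct: `IsAlgebraic ℚ (exp (e i))` -/

/-- The crux with the adjoined numbers restricted to ALGEBRAIC ones (the disjunct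
`IsAlgebraic ℚ (Complex.exp (e i))` dropped). -/
def NomeHygieneAlgOnly : Prop :=
  ∀ (n : ℕ) (z : Fin n → ℂ), LinearIndependent ℚ z → ∃ (k : ℕ) (e : Fin k → ℂ) (w : Fin (n + k) → ℂ), (∀ i, IsAlgebraic ℚ (e i)) ∧ LinearIndependent ℚ w ∧ Submodule.span ℚ (Set.range w) = Submodule.span ℚ (Set.range z ∪ Set.range e) ∧ (2 * (Real.pi : ℂ) * Complex.I) ∈ Submodule.span ℚ (Set.range w) ∧ (∀ j, (w j).re < 0) ∧ (∀ j, ∀ b c : ℚ, (w j / (2 * (Real.pi : ℂ) * Complex.I)) ^ 2 + (b : ℂ) * (w j / (2 * (Real.pi : ℂ) * Complex.I)) + (c : ℂ) ≠ 0) ∧ (∀ i j, i ≠ j → ∀ a b c d : ℚ, 0 < a * d - b * c → (w j / (2 * (Real.pi : ℂ) * Complex.I)) * ((c : ℂ) * (w i / (2 * (Real.pi : ℂ) * Complex.I)) + (d : ℂ)) ≠ (a : ℂ) * (w i / (2 * (Real.pi : ℂ) * Complex.I)) + (b : ℂ))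

/-- **Any proof must use the `exp`-algebraic option** (to bring `2πi` into the span): at `n = 0`,
algebraic `e` span a subspace of `ℚ̄`, which misses `2πi` (Lindemann; tree
`Literature.NumberTheory.Transcendental.transcendental_two_pi_I`). [cite: Lindemann1882] -/
theorem nomeHygiene_false_without_expOption : ¬ NomeHygieneAlgOnly := by
  intro h
  obtain ⟨k, e, w, he, -, hspan, hmem, -⟩ :=
    h 0 (Fin.elim0 : Fin 0 → ℂ) linearIndependent_empty_type
  rw [hspan] at hmem
  have hsub : Submodule.span ℚ (Set.range (Fin.elim0 : Fin 0 → ℂ) ∪ Set.range e) ≤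
      Subalgebra.toSubmodule (integralClosure ℚ ℂ) := by
    rw [Submodule.span_le]
    rintro x (⟨i, -⟩ | ⟨i, rfl⟩)
    · exact i.elim0
    · exact (mem_integralClosure_iff ℚ ℂ).2 (he i).isIntegral
  have hint : IsIntegral ℚ (2 * (Real.pi : ℂ) * Complex.I) :=
    (mem_integralClosure_iff ℚ ℂ).1 (hsub hmem)
  exact Literature.NumberTheory.Transcendental.transcendental_two_pi_I hint.isAlgebraic

/-! ## (c) The cubic trap: the enlargement `∃ k e` is load-bearing; "at most two shifts" is false for an algebraic direction -/

open Polynomial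

/-! ## The trap in `K(τ) = span_ℚ(1, τ, τ²)`, `τ` a root of a monic rational cubic -/

section trap

variable {τ : ℂ} {p q r : ℚ}

/-- `1 ∈ K(τ)`. -/
theorem one_mem_K (τ : ℂ) : (1 : ℂ) ∈ Submodule.span ℚ (Set.range ![(1 : ℂ), τ, τ ^ 2]) :=
  Submodule.subset_span ⟨0, rfl⟩

/-- `τ ∈ K(τ)`. -/
theorem self_mem_K (τ : ℂ) : τ ∈ Submodule.span ℚ (Set.range ![(1 : ℂ), τ, τ ^ 2]) :=
  Submodule.subset_span ⟨1, rfl⟩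

/-- `τ² ∈ K(τ)`. -/
theorem sq_mem_K (τ : ℂ) : τ ^ 2 ∈ Submodule.span ℚ (Set.range ![(1 : ℂ), τ, τ ^ 2]) :=
  Submodule.subset_span ⟨2, rfl⟩

/-- `K(τ)` is stable under multiplication by `τ` when `τ³ ∈ K(τ)`. [folklore] -/
theorem tau_mul_mem_K (hτ : τ ^ 3 = p + q * τ + r * τ ^ 2) {y : ℂ}
    (hy : y ∈ Submodule.span ℚ (Set.range ![(1 : ℂ), τ, τ ^ 2])) :
    τ * y ∈ Submodule.span ℚ (Set.range ![(1 : ℂ), τ, τ ^ 2]) := by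
  induction hy using Submodule.span_induction with
  | mem x hx =>
    obtain ⟨i, rfl⟩ := hx
    fin_cases i
    · simpa using self_mem_K τ
    · simpa [← sq] using sq_mem_K τ
    · have h3 : τ * τ ^ 2 = (p • (1 : ℂ) + q • τ + r • τ ^ 2 : ℂ) := by
        simp only [Rat.smul_def, mul_one]
        rw [← hτ]
        ring
      have hmem : (p • (1 : ℂ) + q • τ + r • τ ^ 2 : ℂ) ∈
          Submodule.span ℚ (Set.range ![(1 : ℂ), τ, τ ^ 2]) :=
        Submodule.add_mem _ (Submodule.add_mem _ (Submodule.smul_mem _ p (one_mem_K τ))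
          (Submodule.smul_mem _ q (self_mem_K τ))) (Submodule.smul_mem _ r (sq_mem_K τ))
      simpa [h3] using hmem
  | zero => simp
  | add x y _ _ hx hy => rw [mul_add]; exact Submodule.add_mem _ hx hy
  | smul a x _ hx => rw [mul_smul_comm]; exact Submodule.smul_mem _ a hx

/-- `K(τ)` is closed under multiplication when `τ³ ∈ K(τ)`. [folklore] -/
theorem mul_mem_K (hτ : τ ^ 3 = p + q * τ + r * τ ^ 2) {x y : ℂ}
    (hx : x ∈ Submodule.span ℚ (Set.range ![(1 : ℂ), τ, τ ^ 2]))
    (hy : y ∈ Submodule.span ℚ (Set.range ![(1 : ℂ), τ, τ ^ 2])) :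
    x * y ∈ Submodule.span ℚ (Set.range ![(1 : ℂ), τ, τ ^ 2]) := by
  induction hx using Submodule.span_induction with
  | mem x hx =>
    obtain ⟨i, rfl⟩ := hx
    fin_cases i
    · simpa using hy
    · simpa using tau_mul_mem_K hτ hy
    · have : τ ^ 2 * y = τ * (τ * y) := by ring
      simpa [this] using tau_mul_mem_K hτ (tau_mul_mem_K hτ hy)
  | zero => simp
  | add x x' _ _ hx hx' => rw [add_mul]; exact Submodule.add_mem _ hx hx'
  | smul a x _ hx => rw [smul_mul_assoc]; exact Submodule.smul_mem _ a hx

/-- Four vectors `1, x, y, xy` of the (at most) 3-dimensional algebra `K(τ)` are dependent. -/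
theorem not_linearIndependent_four (hτ : τ ^ 3 = p + q * τ + r * τ ^ 2) {x y : ℂ}
    (hx : x ∈ Submodule.span ℚ (Set.range ![(1 : ℂ), τ, τ ^ 2]))
    (hy : y ∈ Submodule.span ℚ (Set.range ![(1 : ℂ), τ, τ ^ 2])) :
    ¬ LinearIndependent ℚ ![(1 : ℂ), x, y, x * y] := by
  intro hli
  have h4 : Module.finrank ℚ (Submodule.span ℚ (Set.range ![(1 : ℂ), x, y, x * y])) = 4 := by
    rw [finrank_span_eq_card hli, Fintype.card_fin]
  have hle : Submodule.span ℚ (Set.range ![(1 : ℂ), x, y, x * y]) ≤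
      Submodule.span ℚ (Set.range ![(1 : ℂ), τ, τ ^ 2]) := by
    rw [Submodule.span_le]
    rintro _ ⟨i, rfl⟩
    fin_cases i
    · simpa using one_mem_K τ
    · simpa using hx
    · simpa using hy
    · simpa using mul_mem_K hτ hx hy
  haveI : FiniteDimensional ℚ (Submodule.span ℚ (Set.range ![(1 : ℂ), τ, τ ^ 2])) :=
    FiniteDimensional.span_of_finite ℚ (Set.finite_range _)
  have hmono := Submodule.finrank_mono hle
  have h3 : Module.finrank ℚ (Submodule.span ℚ (Set.range ![(1 : ℂ), τ, τ ^ 2])) ≤ 3 :=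
    (finrank_range_le_card _).trans (by simp)
  omega

/-- **The cubic trap.** If `τ` is a root of a monic rational cubic then any two points `x, y` of
`K(τ) = span_ℚ(1, τ, τ²)` in the upper half plane are `GL₂⁺(ℚ)`-related in the crux's polynomial
form: `y (c x + d) = a x + b` with `a d − b c > 0`. [folklore] -/
theorem cubicTrap (hτ : τ ^ 3 = p + q * τ + r * τ ^ 2) {x y : ℂ}
    (hx : x ∈ Submodule.span ℚ (Set.range ![(1 : ℂ), τ, τ ^ 2]))
    (hy : y ∈ Submodule.span ℚ (Set.range ![(1 : ℂ), τ, τ ^ 2]))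
    (hxi : 0 < x.im) (hyi : 0 < y.im) :
    ∃ a b c d : ℚ, 0 < a * d - b * c ∧ y * ((c : ℂ) * x + (d : ℂ)) = (a : ℂ) * x + (b : ℂ) := by
  have hdep := not_linearIndependent_four hτ hx hy
  rw [Fintype.not_linearIndependent_iff] at hdep
  obtain ⟨g, hsum, i, hi⟩ := hdep
  rw [Fin.sum_univ_four] at hsum
  simp only [Matrix.cons_val_zero, Matrix.cons_val_one, Matrix.head_cons, Matrix.cons_val_two,
    Matrix.tail_cons, Matrix.cons_val_three, Rat.smul_def, mul_one] at hsum
  -- hsum : ↑(g 0) + ↑(g 1) * x + ↑(g 2) * y + ↑(g 3) * (x * y) = 0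
  have hrel : y * (((g 3 : ℚ) : ℂ) * x + ((g 2 : ℚ) : ℂ)) = ((-g 1 : ℚ) : ℂ) * x + ((-g 0 : ℚ) : ℂ) := by
    push_cast
    linear_combination hsum
  obtain ⟨hre, him⟩ := Complex.ext_iff.1 hrel
  simp only [Complex.mul_re, Complex.mul_im, Complex.add_re, Complex.add_im, Complex.ratCast_re,
    Complex.ratCast_im, zero_mul, sub_zero, add_zero] at hre him
  push_cast at hre him
  have hxim : x.im ≠ 0 := hxi.ne'
  -- `c x + d ≠ 0`, in real coordinates: not both `g 3 = 0` and `g 2 = 0`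
  have hne : ¬ ((g 3 : ℝ) = 0 ∧ (g 2 : ℝ) = 0) := by
    rintro ⟨h3, h2⟩
    have h3' : g 3 = 0 := by exact_mod_cast h3
    have h2' : g 2 = 0 := by exact_mod_cast h2
    rw [h3', h2'] at hsum
    push_cast at hsum
    simp only [zero_mul, add_zero] at hsum
    obtain ⟨hre0, him0⟩ := Complex.ext_iff.1 hsum
    simp only [Complex.add_re, Complex.add_im, Complex.mul_re, Complex.mul_im, Complex.ratCast_re,
      Complex.ratCast_im, zero_mul, sub_zero, add_zero, zero_add, Complex.zero_re,
      Complex.zero_im] at hre0 him0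
    have h1 : (g 1 : ℝ) = 0 := by
      rcases mul_eq_zero.1 him0 with h | h
      · exact h
      · exact absurd h hxim
    have h1' : g 1 = 0 := by exact_mod_cast h1
    rw [h1, zero_mul, add_zero] at hre0
    have h0' : g 0 = 0 := by exact_mod_cast hre0
    fin_cases i <;> simp_all
  refine ⟨-g 1, -g 0, g 3, g 2, ?_, hrel⟩
  -- the determinant sign from `Im y · |c x + d|² = (ad - bc) · Im x`
  have hid : y.im * (((g 3 : ℝ) * x.re + g 2) ^ 2 + ((g 3 : ℝ) * x.im) ^ 2) =
      x.im * ((-(g 1 : ℝ)) * g 2 - (-(g 0 : ℝ)) * g 3) := by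
    linear_combination ((g 3 : ℝ) * x.re + g 2) * him - ((g 3 : ℝ) * x.im) * hre
  have hsq : 0 < ((g 3 : ℝ) * x.re + g 2) ^ 2 + ((g 3 : ℝ) * x.im) ^ 2 := by
    rcases eq_or_ne (g 3 : ℝ) 0 with h3 | h3
    · have h2 : (g 2 : ℝ) ≠ 0 := fun h2 => hne ⟨h3, h2⟩
      rw [h3, zero_mul, zero_add, zero_mul]
      positivity
    · have : (g 3 : ℝ) * x.im ≠ 0 := mul_ne_zero h3 hxim
      positivity
  have hprod : 0 < x.im * ((-(g 1 : ℝ)) * g 2 - (-(g 0 : ℝ)) * g 3) := by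
    rw [← hid]; positivity
  have hdet : 0 < (-(g 1 : ℝ)) * g 2 - (-(g 0 : ℝ)) * g 3 := (mul_pos_iff_of_pos_left hxi).1 hprod
  exact_mod_cast hdet

end trap

/-! ## The witness cell: a root `τ` of `X³ + 2` in the open first quadrant

All cell lemmas are parametric in `τ` with the hypothesis `τ³ = −2` (plus `Re τ > 0`, `Im τ > 0` where
needed); the explicit root `∛2 · e^{iπ/3}` appears only inside `exists_firstQuadrant_root`, so this
support file declares no definitions and no notation. -/

section cell

variable {τ : ℂ}

/-- There is a root of `X³ + 2` with positive real and imaginary parts: `τ = ∛2 · (1/2 + i√3/2)`.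
[folklore] -/
theorem exists_firstQuadrant_root : ∃ τ : ℂ, τ ^ 3 = -2 ∧ 0 < τ.re ∧ 0 < τ.im := by
  set ρ : ℝ := (2 : ℝ) ^ ((3 : ℝ)⁻¹) with hρdef
  have hρpos : 0 < ρ := Real.rpow_pos_of_pos (by norm_num) _
  have hρ : ρ ^ 3 = 2 := by
    rw [hρdef, ← Real.rpow_natCast, ← Real.rpow_mul (by norm_num)]
    norm_num
  have h3 : Real.sqrt 3 * Real.sqrt 3 = 3 := Real.mul_self_sqrt (by norm_num)
  refine ⟨⟨ρ / 2, ρ * Real.sqrt 3 / 2⟩, ?_, ?_, ?_⟩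
  · apply Complex.ext
    · simp only [pow_succ, pow_zero, one_mul, Complex.mul_re, Complex.mul_im, Complex.neg_re,
        Complex.re_ofNat]
      linear_combination (-1 : ℝ) * hρ - (3 * ρ ^ 3 / 8) * h3
    · simp only [pow_succ, pow_zero, one_mul, Complex.mul_re, Complex.mul_im, Complex.neg_im,
        Complex.im_ofNat]
      linear_combination (-(ρ ^ 3 * Real.sqrt 3 / 8)) * h3
  · show 0 < ρ / 2
    positivity
  · show 0 < ρ * Real.sqrt 3 / 2
    positivity

/-- `Im τ² = 2 Re τ Im τ > 0` in the open first quadrant. -/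
theorem sq_im_pos (hre : 0 < τ.re) (him : 0 < τ.im) : 0 < (τ ^ 2).im := by
  have h : (τ ^ 2).im = 2 * τ.re * τ.im := by
    rw [sq, Complex.mul_im]; ring
  rw [h]
  positivity

/-- `τ³ = −2` in the monic-cubic form consumed by `cubicTrap`. -/
theorem cubic_form (hτ3 : τ ^ 3 = -2) :
    τ ^ 3 = ((-2 : ℚ) : ℂ) + ((0 : ℚ) : ℂ) * τ + ((0 : ℚ) : ℂ) * τ ^ 2 := by
  rw [hτ3]; push_cast; ring

/-- `−2` is not a rational cube (2-adic valuation). [folklore] -/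
theorem ne_neg_two_of_cube (b : ℚ) : b ^ 3 ≠ -2 := by
  intro hb
  have hb0 : b ≠ 0 := by
    rintro rfl
    norm_num at hb
  have hv : padicValRat 2 (b ^ 3) = padicValRat 2 (-2) := by rw [hb]
  rw [padicValRat.pow, padicValRat.neg] at hv
  have h2 : padicValRat 2 (2 : ℚ) = 1 := by
    have := padicValRat.self (p := 2) (by norm_num)
    exact_mod_cast this
  rw [h2] at hv
  omega

/-- `X³ + 2` is irreducible over `ℚ`, so it is the minimal polynomial of any of its roots.
[folklore] -/
theorem minpoly_eq_of_cube (hτ3 : τ ^ 3 = -2) : minpoly ℚ τ = X ^ 3 - C (-2 : ℚ) := by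
  symm
  refine minpoly.eq_of_irreducible_of_monic
    (X_pow_sub_C_irreducible_of_prime Nat.prime_three ne_neg_two_of_cube) ?_
    (monic_X_pow_sub_C _ (by norm_num))
  simp [hτ3]

/-- `1, τ, τ²` are `ℚ`-linearly independent for a root `τ` of `X³ + 2` (degree 3). [folklore] -/
theorem linearIndependent_one_self_sq (hτ3 : τ ^ 3 = -2) :
    LinearIndependent ℚ ![(1 : ℂ), τ, τ ^ 2] := by
  rw [Fintype.linearIndependent_iff]
  intro g hg
  rw [Fin.sum_univ_three] at hg
  simp only [Matrix.cons_val_zero, Matrix.cons_val_one, Matrix.head_cons, Matrix.cons_val_two,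
    Matrix.tail_cons, Rat.smul_def, mul_one] at hg
  -- the quadratic `Q = g₂ X² + g₁ X + g₀` vanishes at `τ`
  set Q : ℚ[X] := C (g 2) * X ^ 2 + C (g 1) * X + C (g 0) with hQ
  have hQeval : aeval τ Q = 0 := by
    simp only [hQ, map_add, map_mul, aeval_C, aeval_X, map_pow, eq_ratCast]
    linear_combination hg
  by_cases hQ0 : Q = 0
  · have h0 : Q.coeff 0 = g 0 := by simp [hQ]
    have h1 : Q.coeff 1 = g 1 := by simp [hQ]
    have h2 : Q.coeff 2 = g 2 := by simp [hQ]
    rw [hQ0] at h0 h1 h2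
    simp only [coeff_zero] at h0 h1 h2
    intro i
    fin_cases i
    · exact h0.symm
    · exact h1.symm
    · exact h2.symm
  · exfalso
    have hdeg := minpoly.degree_le_of_ne_zero ℚ τ hQ0 hQeval
    rw [minpoly_eq_of_cube hτ3, degree_X_pow_sub_C (by norm_num) (-2 : ℚ)] at hdeg
    have hQdeg : Q.degree ≤ 2 := degree_quadratic_le
    have : (3 : WithBot ℕ) ≤ 2 := (hdeg.trans hQdeg)
    exact absurd this (by decide)

/-- The cell `z = 2πi · (1, τ, τ²)` is `ℚ`-linearly independent. -/
theorem linearIndependent_cell (hτ3 : τ ^ 3 = -2) :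
    LinearIndependent ℚ (fun j : Fin 3 => (2 * (Real.pi : ℂ) * Complex.I) * ![(1 : ℂ), τ, τ ^ 2] j) := by
  have hker : LinearMap.ker (LinearMap.mulLeft ℚ (2 * (Real.pi : ℂ) * Complex.I)) = ⊥ :=
    LinearMap.ker_eq_bot.2 (mul_right_injective₀ twoPiI_ne_zero)
  have h := (linearIndependent_one_self_sq hτ3).map' _ hker
  have hfun : ((LinearMap.mulLeft ℚ (2 * (Real.pi : ℂ) * Complex.I)) ∘ ![(1 : ℂ), τ, τ ^ 2] :
      Fin 3 → ℂ) = fun j : Fin 3 => (2 * (Real.pi : ℂ) * Complex.I) * ![(1 : ℂ), τ, τ ^ 2] j := by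
    funext j
    simp only [Function.comp_apply, LinearMap.mulLeft_apply]
  rw [← hfun]
  exact h

/-- `2πi = z₀ ∈ span z`. -/
theorem twoPiI_mem_span_cell (τ : ℂ) :
    (2 * (Real.pi : ℂ) * Complex.I) ∈ Submodule.span ℚ
      (Set.range (fun j : Fin 3 => (2 * (Real.pi : ℂ) * Complex.I) * ![(1 : ℂ), τ, τ ^ 2] j)) :=
  Submodule.subset_span ⟨0, by simp⟩

/-- Every vector of `span z` has its nome in `K(τ)`. -/
theorem nome_mem_K_of_mem_span_cell (τ : ℂ) {w : ℂ}
    (hw : w ∈ Submodule.span ℚ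
      (Set.range (fun j : Fin 3 => (2 * (Real.pi : ℂ) * Complex.I) * ![(1 : ℂ), τ, τ ^ 2] j))) :
    w / (2 * (Real.pi : ℂ) * Complex.I) ∈ Submodule.span ℚ (Set.range ![(1 : ℂ), τ, τ ^ 2]) := by
  obtain ⟨c, hc⟩ := (Submodule.mem_span_range_iff_exists_fun ℚ).1 hw
  have hsum : (2 * (Real.pi : ℂ) * Complex.I) * (∑ j, c j • ![(1 : ℂ), τ, τ ^ 2] j) = w := by
    rw [← hc, Finset.mul_sum]
    refine Finset.sum_congr rfl fun j _ => ?_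
    simp only [mul_smul_comm]
  have hdiv : w / (2 * (Real.pi : ℂ) * Complex.I) = ∑ j, c j • ![(1 : ℂ), τ, τ ^ 2] j := by
    rw [← hsum, mul_div_cancel_left₀ _ twoPiI_ne_zero]
  rw [hdiv]
  exact Submodule.sum_mem _ fun j _ => Submodule.smul_mem _ _ (Submodule.subset_span ⟨j, rfl⟩)

end cell

/-- **The enlargement is load-bearing.** The crux with `k = 0` forced — re-base `span z` itself into
Tate position — is false even under `2πi ∈ span z` and `3 ≤ n`: on the cubic cell
`z = 2πi · (1, τ, τ²)` (`τ³ = −2`, `Re τ, Im τ > 0`) every basis `w` of `span z` has two nomes in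
`K(τ) ∩ ℍ`, which the cubic trap relates by an element of `GL₂⁺(ℚ)`. [folklore] -/
theorem nomeHygiene_false_without_enlargement :
    ¬ ∀ (n : ℕ) (z : Fin n → ℂ), LinearIndependent ℚ z → (2 * (Real.pi : ℂ) * Complex.I) ∈ Submodule.span ℚ (Set.range z) → 3 ≤ n → ∃ (w : Fin n → ℂ), LinearIndependent ℚ w ∧ Submodule.span ℚ (Set.range w) = Submodule.span ℚ (Set.range z) ∧ (2 * (Real.pi : ℂ) * Complex.I) ∈ Submodule.span ℚ (Set.range w) ∧ (∀ j, (w j).re < 0) ∧ (∀ j, ∀ b c : ℚ, (w j / (2 * (Real.pi : ℂ) * Complex.I)) ^ 2 + (b : ℂ) * (w j / (2 * (Real.pi : ℂ) * Complex.I)) + (c : ℂ) ≠ 0) ∧ (∀ i j, i ≠ j → ∀ a b c d : ℚ, 0 < a * d - b * c → (w j / (2 * (Real.pi : ℂ) * Complex.I)) * ((c : ℂ) * (w i / (2 * (Real.pi : ℂ) * Complex.I)) + (d : ℂ)) ≠ (a : ℂ) * (w i / (2 * (Real.pi : ℂ) * Complex.I)) + (b : ℂ)) := by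
  intro h
  obtain ⟨τ, hτ3, -, -⟩ := exists_firstQuadrant_root
  obtain ⟨w, -, hspan, -, hre, -, hiso⟩ :=
    h 3 _ (linearIndependent_cell hτ3) (twoPiI_mem_span_cell τ) le_rfl
  have hw : ∀ j, w j ∈ Submodule.span ℚ
      (Set.range (fun j : Fin 3 => (2 * (Real.pi : ℂ) * Complex.I) * ![(1 : ℂ), τ, τ ^ 2] j)) :=
    fun j => by rw [← hspan]; exact Submodule.subset_span ⟨j, rfl⟩
  have himpos : ∀ j, 0 < (w j / (2 * (Real.pi : ℂ) * Complex.I)).im := fun j => by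
    rw [im_div_twoPiI]
    exact div_pos (by linarith [hre j]) (by positivity)
  obtain ⟨a, b, c, d, hdet, hrel⟩ := cubicTrap (cubic_form hτ3)
    (nome_mem_K_of_mem_span_cell τ (hw 0)) (nome_mem_K_of_mem_span_cell τ (hw 1)) (himpos 0) (himpos 1)
  exact hiso 0 1 (by decide) a b c d hdet hrel

/-- **"At most two shifts" is false for an algebraic direction.** The crux docstring's mechanism
("for independent `u, v` with `1 ∉ span_ℚ(u, v)` at most two `t ∈ ℕ` make `u + t·v` equivalent to a
given point") fails in `K(τ)`, `τ³ = −2`, `Re τ, Im τ > 0`: with `u = τ`, `v = τ²` (`1, τ, τ²`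
independent) and the point `p = τ`, EVERY `t ∈ ℕ` gives a `GL₂⁺(ℚ)`-coincidence. (Correct form = the
landed Key Lemma `stub_shiftCoincidence`, whose direction `1/2πi` is transcendental.) [folklore] -/
theorem not_finite_shift_coincidences :
    ¬ ∀ (u v p : ℂ), LinearIndependent ℚ ![(1 : ℂ), u, v] →
      Set.Finite {t : ℕ | ∃ a b c d : ℚ, 0 < a * d - b * c ∧
        (u + (t : ℂ) * v) * ((c : ℂ) * p + (d : ℂ)) = (a : ℂ) * p + (b : ℂ)} := by
  intro h
  obtain ⟨τ, hτ3, hre, him⟩ := exists_firstQuadrant_root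
  have hfin := h τ (τ ^ 2) τ (linearIndependent_one_self_sq hτ3)
  apply Set.infinite_univ (α := ℕ)
  refine Set.Finite.subset hfin fun t _ => ?_
  have hy : τ + (t : ℂ) * τ ^ 2 ∈ Submodule.span ℚ (Set.range ![(1 : ℂ), τ, τ ^ 2]) := by
    have : (t : ℂ) * τ ^ 2 = (t : ℚ) • τ ^ 2 := by rw [Rat.smul_def]; push_cast; rfl
    rw [this]
    exact Submodule.add_mem _ (self_mem_K τ) (Submodule.smul_mem _ _ (sq_mem_K τ))
  have hyi : 0 < (τ + (t : ℂ) * τ ^ 2).im := by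
    have h2 := sq_im_pos hre him
    simp only [Complex.add_im, Complex.mul_im, Complex.natCast_re, Complex.natCast_im, zero_mul,
      add_zero]
    positivity
  exact cubicTrap (cubic_form hτ3) (self_mem_K τ) hy him hyi

end Summit.Schanuel.Schanuel.Cruxes.NomeHygiene.Disproof
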